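import Summits.QuantumFields.YangMills.Theorems.BalabanUVNodesN07DPrimeTruncationRows
import Summits.QuantumFields.YangMills.Theorems.BalabanUVNodesN07DPrimeChartDictionary
import Summits.QuantumFields.YangMills.Theorems.BalabanUVNodesN07HalvingStepTopOfLocalLetters
import Summits.QuantumFields.YangMills.Theorems.BalabanUVNodesK0Stub1FlatAveragingDictionary
import Summits.QuantumFields.YangMills.Theorems.UnitScaleTiltProp8ChartDoubleBarLogSecondOrder
import HarnessLib

/-!
# N07 [B11] ∕ K0⁷ road, chart side — MODULE 115: **THE (d′)-Lam ASSEMBLY KIT** — (i) ℂ-linear maps with a prescribed real kernel (the inhabitants of S4's kernel-formula binders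
# `DV GV QV MV`), (ii) the three (158)∕(165) letters `Letters10On` are LOCAL (they read the field only on the bonds of the window) and HOMOGENEOUS under the chart scalar `iη`,
# (iii) the truncation `Ã = 𝟙_{π″□₀}·A` has the supplier's GLOBAL WEIGHTED GRADIENT ROW `w₂(b)·L^{k}·‖Ã(b+e_ν) − Ã b‖ ≤ κε·L²` from print's (152) SECOND member on the tower

Cell `pub-ymgap`, seat `pub-ymgap-dag-n07-e` g30 (FAN-OUT §N07 row s3; LANE OWNER of the K0 road chart side), MODULE 115 = the kit of the (d′)-Lam assembly (`DPRIME-LAM-ROADMAP.md` §3,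
desk memo ⚑ `LOCATED-DPRIME-T2-GRADIENT.md`).  `--kind proof --supports stmt-QuantumFields-20541 --as helper` (K0⁷); count-neutral; theorems only.
[15] = [Balaban1985Variational]; [6] = [Balaban1985RegularSpaces]; [4] = [Balaban1984PropagatorsII].

WHY.  The supplier of the (d′) letter (S4-Lam, MODULE 114) concludes `Letters10On Y η t (⇑X − H_V(Q_V ⇑X))` for the 𝔰𝔲(N)-valued chart parameter `X = iη·A′` read through GLOBAL
kernel-formula letters and GLOBAL weighted rows; the head token's (d′) letter is `Letters10On (π(box)) η t₁ (A − H_V(𝟙_reach·QA))` for the gauge potential `A` of the tower.  Three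
pieces of bookkeeping connect them: the kernel-formula letters are inhabited (§1); `Letters10On` only reads bonds with both ends in the window and scales by `|iη| = η` (§2); and the
supplier's gradient window (print's (152) second member `(L^{j′}η)²|∇^ηA|` on every `□_{j′}`, [15] p.301 — the located conjunct (T2b)) passes to the truncation `Ã` with the constant `L²`:
a bond issuing from a site of meet-level `j ≥ 1`, together with its translates by one lattice step, lies in `π″□_{j−1}` (MODULE 107 `mem_bonds_pred_of_inOm`), so the derivative
stencil `(x, ν, μ)` is a stencil of `π″□_{j−1}`, where (T2b) reads `‖∇^η_νA_μ(x)‖ < κε·L^{2(k−j+1)}`; the weight `(L^jη)²·L^k·η` turns this into `κε·L²`; at level `0` the cut costs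
`η²·L^k·κεL^k = κε` (§3).

WHAT IS PROVED (sorry-free; no definition; axioms standard).
§1 `exists_kernelMapC` (any finite index types, any real kernel `κ j t`: a ℂ-linear `T` with `T A t = Σ_j ((κ j t : ℝ) : ℂ) • A j`).
§2 ★ `Letters10On.congr_bonds` (two fields agreeing on `(regionOfSet Y).bonds` have the same letters on `Y`), ★ `Letters10On.of_I_eta_smul` (`Letters10On Y ξ t (iη•Z) → Letters10On Y ξ (t∕η) Z`,
`η > 0`), `grad_norm_eq` (`‖F(x+e_μ) − F x‖ = ξ·‖∇^ξ_μF(x)‖`).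
§3 ★ `truncation_gradRows_of_T2b_aux` (abstract level function), ★★★ `truncation_gradRows_of_T2b` (the meet `cubeDomains ⊓ D₂`, `1 ≤ k ≤ m + K`, `ρ ≥ 2`:
`∀ b ν, w 2 b · L^k · ‖Ã ⟨b₋+e_ν, b_dir⟩ − Ã b‖ ≤ κε·L²`).
§4 ★★ `slice_row_chart_of_eq` (the (153) slice row of the chart parameter `X = iη(Ã + H Z)` on any `D′ =` the meet: `R∂*(Re φ X) = 0` from the head token's two slice rows of `A` —
MODULES 107 §3, 105 §3 and `Re(iη·z) = −η·Im z`), ★★ `letters_transfer_of_eq` (on a window `Y ⊆ π″□₀`: `Letters10On Y ξ t (Ã − H_V(Q_V Ã)) → Letters10On Y ξ t (A − H_V(𝟙_reach·QA))` —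
§2's locality, MODULE 106 `kernelH_indicator_reach_eq`, k0-s1 `QV_apply_eq_bondAvgIter`, UST `bondAvgIter_congr_of_reads`).
HONEST FRAMING: linear algebra + lattice bookkeeping by name; NOTHING of [15]'s estimates asserted; (d′) ∕ `HThm4RecDbar` ∕ budget row of MODULE 100 untouched; K0⁷ NOT closed; N07 NOT
discharged; counts unmoved; one finite 𝕋⁴ programme at fixed ε — NOT continuum ∕ ℝ⁴ ∕ OS ∕ mass gap ∕ Clay.  No `sorry`, no `def`, no `instance`, no `notation`.

References: [15] (152) p.301, (157)–(159) pp.302–303, (165) p.304; [6] p.98, (1.131) p.99, (1.136) p.99; [4] (2.3) p.224, (2.20) p.226, (2.35) p.228.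
-/

set_option autoImplicit false

noncomputable section

open scoped BigOperators Matrix.Norms.L2Operator

namespace Summit.QuantumFields.YangMills.BalabanUVNodes.N07DPrimeAssemblyKit

open Literature.MathematicalPhysics.QuantumFieldTheory.Balaban1983to89
open Literature.MathematicalPhysics.QuantumFieldTheory.Balaban1983to89.B5Eq118OneStroke (iterBlockOf)
open Literature.MathematicalPhysics.QuantumFieldTheory.Balaban1983to89.B6SectADomainsV1 (Domains)
open Literature.MathematicalPhysics.QuantumFieldTheory.Balaban1983to89.B14DomainGeom (Pt)
open Literature.MathematicalPhysics.QuantumFieldTheory.Balaban1983to89.B15Eq112TorusCover (cover)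
open Literature.MathematicalPhysics.QuantumFieldTheory.Balaban1983to89.B8Eq131Cubes (cube cube_anti)
open Literature.MathematicalPhysics.QuantumFieldTheory.Balaban1983to89.B12RegularSpaces111 (grad)
open Literature.MathematicalPhysics.QuantumFieldTheory.Balaban1983to89.Node00
open Summit.QuantumFields.YangMills.Theorems.K0FlatCubeOpsTextP (IsLevWeight)
open Summit.QuantumFields.YangMills.BalabanUVNodes.N07HalvingStepTopOfLocalLetters (Letters10On)
open Summit.QuantumFields.YangMills.BalabanUVNodes.N07DPrimeTruncationRows (mem_bonds_pred_of_inOm inOm_cube_levOf RE_dsE_truncation_eq)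
open Summit.QuantumFields.YangMills.BalabanUVNodes.N07DPrimeReachDictionary (kernelH_indicator_reach_eq)
open Summit.QuantumFields.YangMills.BalabanUVNodes.N07DPrimeChartDictionary (RE_dsE_re_add_kernelH)
open Summit.QuantumFields.YangMills.Theorems (K0Stub1FlatAveragingDictionary.QV_apply_eq_bondAvgIter)
open Summit.QuantumFields.YangMills.Theorems.Prop8ChartDoubleBar (bondAvgIter_congr_of_reads)
open Summit.QuantumFields.YangMills.Theorems.K0FlatCubeOpsTextP (flatH)
open Literature.MathematicalPhysics.QuantumFieldTheory.Balaban1983to89.B6SectAOperatorsV1 (BondIdx RE dsE QE)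
open Literature.MathematicalPhysics.QuantumFieldTheory.BalabanImbrieJaffe1984to88.BIJ85AxialPropagator411 (BondSpace)
open LatticeFieldCalculus (bondAvgIter)

/-! ## §1  ℂ-linear maps with a prescribed real kernel -/

section Kernel

variable {ι τ V : Type*} [Fintype ι] [AddCommGroup V] [Module ℂ V]

/-- **A ℂ-LINEAR MAP WITH A PRESCRIBED REAL KERNEL EXISTS**: for every real kernel `κ : ι → τ → ℝ` the map `A ↦ (t ↦ Σ_j ((κ j t : ℝ) : ℂ) • A j)` is ℂ-linear — the inhabitant of the
kernel-formula binders `hDV hGV hQV hHV hMV` of the (158) suppliers (k0-s1 S4 ∕ n07-e S4-Lam), at the kernels `e_j ↦ (δ_a e_j)(b)`, `((G − HQG) e_j)(b)`, `(Q e_j)(t)`, `(H e_t)(b)`, `(Q*EQG e_j)(b)`.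
[cite: Balaban1985Variational, (157)–(158) p.302; Balaban1984PropagatorsII, (2.20) p.226, (2.35) p.228] -/
theorem exists_kernelMapC (κ : ι → τ → ℝ) :
    ∃ T : (ι → V) →ₗ[ℂ] (τ → V), ∀ (A : ι → V) (t : τ), T A t = ∑ j, ((κ j t : ℝ) : ℂ) • A j := by
  refine ⟨{ toFun := fun A t => ∑ j, ((κ j t : ℝ) : ℂ) • A j
            map_add' := fun A A' => ?_
            map_smul' := fun a A => ?_ }, fun A t => rfl⟩
  · funext t
    show ∑ j, ((κ j t : ℝ) : ℂ) • (A + A') j = (∑ j, ((κ j t : ℝ) : ℂ) • A j) + ∑ j, ((κ j t : ℝ) : ℂ) • A' j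
    simp only [Pi.add_apply, smul_add, Finset.sum_add_distrib]
  · funext t
    show ∑ j, ((κ j t : ℝ) : ℂ) • (a • A) j = a • ∑ j, ((κ j t : ℝ) : ℂ) • A j
    rw [Finset.smul_sum]
    exact Finset.sum_congr rfl fun j _ => by rw [Pi.smul_apply, smul_comm]

end Kernel

/-! ## §2  The three letters are local and homogeneous -/

section Letters

variable {P : Params} {N : ℕ}

/-- `∇^ξ` of two site functions agreeing at `x` and `x + e_μ`. [cite: Balaban1987RG1, (1.12) p.262 (bookkeeping)] -/
theorem grad_congr (ξ : ℝ) (μ : Fin P.d) (F G : Site P 0 → MatA N) {x : Site P 0} (h0 : F x = G x) (h1 : F (x.shift μ) = G (x.shift μ)) :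
    grad ξ μ F x = grad ξ μ G x := by
  simp only [grad, h0, h1]

/-- `(x − e_μ) + e_μ = x` on the torus. [folklore] -/
private theorem shift_unshift' (x : Site P 0) (μ : Fin P.d) : (x.unshift μ).shift μ = x := by
  funext ν
  by_cases h : ν = μ
  · subst h; simp [Site.shift, Site.unshift]
  · simp [Site.shift, Site.unshift, Function.update_of_ne h]

/-- **THE THREE LETTERS ARE LOCAL**: two bond fields agreeing on `(regionOfSet Y).bonds` (both ends in `Y`) have the same (158)∕(165) letters on `Y` — the three rows read the field at
bonds of `Y`, at the four corners of derivative stencils of `Y`, and on the plaquettes through deep bonds of `Y`, all of which have both ends in `Y`.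
[cite: Balaban1985Variational, (159) p.303, (165) p.304; Balaban1985RegularSpaces, (1.2) p.76, (1.140) p.100] -/
theorem Letters10On.congr_bonds {Y : Set (Site P 0)} {ξ t : ℝ} {X X' : PBond P 0 → MatA N}
    (hXX' : ∀ b ∈ (Sect2.regionOfSet P Y).bonds, X b = X' b) (h : Letters10On Y ξ t X) : Letters10On Y ξ t X' := by
  have hb : ∀ (x : Site P 0) (μ : Fin P.d), x ∈ Y → x.shift μ ∈ Y → X ⟨x, μ⟩ = X' ⟨x, μ⟩ := fun x μ hx hxμ => hXX' ⟨x, μ⟩ ⟨hx, hxμ⟩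
  refine ⟨fun b hb' => ?_, fun q hq => ?_, fun b hbd => ?_⟩
  · rw [← hXX' b hb']; exact h.1 b hb'
  · obtain ⟨h1, h2, h3, h4⟩ := hq
    have e : grad ξ q.2.1 (fun y => X' ⟨y, q.2.2⟩) q.1 = grad ξ q.2.1 (fun y => X ⟨y, q.2.2⟩) q.1 :=
      grad_congr ξ q.2.1 (fun y => X' ⟨y, q.2.2⟩) (fun y => X ⟨y, q.2.2⟩) (hb q.1 q.2.2 h1 h3).symm (hb (q.1.shift q.2.1) q.2.2 h2 h4).symm
    rw [e]; exact h.2.1 q ⟨h1, h2, h3, h4⟩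
  · obtain ⟨hs, ht, hn⟩ := hbd
    -- the co-differential of the curl reads `X` on bonds with both ends among `x, x+e_μ, x±e_ν, x+e_μ±e_ν`
    have hcurl : ∀ (y : Site P 0) (ν μ : Fin P.d), y ∈ Y → y.shift ν ∈ Y → y.shift μ ∈ Y → (y.shift ν).shift μ ∈ Y →
        Sect2.curlA ξ X' y ν μ = Sect2.curlA ξ X y ν μ := by
      intro y ν μ hy hyν hyμ hyνμ
      have hyμν : (y.shift μ).shift ν ∈ Y := by rw [Site.shift_comm]; exact hyνμ
      simp only [Sect2.curlA]
      rw [grad_congr ξ ν (fun z => X' ⟨z, μ⟩) (fun z => X ⟨z, μ⟩) (hb y μ hy hyμ).symm (hb (y.shift ν) μ hyν hyνμ).symm,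
        grad_congr ξ μ (fun z => X' ⟨z, ν⟩) (fun z => X ⟨z, ν⟩) (hb y ν hy hyν).symm (hb (y.shift μ) ν hyμ hyμν).symm]
    have e : Sect2.codiffCurlA ξ X' b.src b.dir = Sect2.codiffCurlA ξ X b.src b.dir := by
      simp only [Sect2.codiffCurlA]
      refine Finset.sum_congr rfl fun ν _ => ?_
      have htgt : b.tgt = b.src.shift b.dir := rfl
      obtain ⟨hsν, hsν', htν, htν'⟩ := hn ν
      rw [htgt] at htν htν'
      have h1 : (b.src.unshift ν).shift ν = b.src := shift_unshift' _ _
      have h2 : (b.src.unshift ν).shift b.dir = (b.src.shift b.dir).unshift ν := (Site.unshift_shift_comm b.src b.dir ν).symm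
      rw [hcurl (b.src.unshift ν) ν b.dir hsν' (by rw [h1]; exact hs) (by rw [h2]; exact htν') (by rw [h1]; exact ht),
        hcurl b.src ν b.dir hs hsν ht (by rw [Site.shift_comm]; exact htν)]
    rw [e]; exact h.2.2 b ⟨hs, ht, hn⟩

/-- `‖(iη)•M‖ = η‖M‖` for `η ≥ 0`. [folklore] -/
theorem norm_I_eta_smul {E : Type*} [SeminormedAddCommGroup E] [NormedSpace ℂ E] {η : ℝ} (hη : 0 ≤ η) (M : E) :
    ‖(Complex.I * (η : ℂ)) • M‖ = η * ‖M‖ := by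
  rw [norm_smul, norm_mul, Complex.norm_I, one_mul, Complex.norm_real, Real.norm_eq_abs, abs_of_nonneg hη]

/-- **THE THREE LETTERS ARE HOMOGENEOUS UNDER THE CHART SCALAR**: `Letters10On Y ξ t (iη•Z) → Letters10On Y ξ (t∕η) Z` for `η > 0` (the rows are built from `∇^ξ` and finite sums,
hence commute with the scalar `iη`, of modulus `η`). [cite: Balaban1985Variational, (152) p.301, (159) p.303, (165) p.304] -/
theorem Letters10On.of_I_eta_smul {Y : Set (Site P 0)} {ξ t η : ℝ} (hη : 0 < η) {Z : PBond P 0 → MatA N}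
    (h : Letters10On Y ξ t (fun b => (Complex.I * (η : ℂ)) • Z b)) : Letters10On Y ξ (t / η) Z := by
  have key : ∀ {v : MatA N}, ‖(Complex.I * (η : ℂ)) • v‖ < t → ‖v‖ < t / η := fun {v} hv => by
    rw [norm_I_eta_smul hη.le] at hv
    rw [lt_div_iff₀ hη, mul_comm]; exact hv
  refine ⟨fun b hb => key (h.1 b hb), fun q hq => key ?_, fun b hb => key ?_⟩
  · have e : (Complex.I * (η : ℂ)) • grad ξ q.2.1 (fun y => Z ⟨y, q.2.2⟩) q.1 = grad ξ q.2.1 (fun y => (Complex.I * (η : ℂ)) • Z ⟨y, q.2.2⟩) q.1 := by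
      simp only [grad, smul_sub, smul_comm (Complex.I * (η : ℂ))]
    rw [e]; exact h.2.1 q hq
  · have ec : ∀ (y : Site P 0) (ν μ : Fin P.d), Sect2.curlA ξ (fun b => (Complex.I * (η : ℂ)) • Z b) y ν μ = (Complex.I * (η : ℂ)) • Sect2.curlA ξ Z y ν μ := by
      intro y ν μ
      simp only [Sect2.curlA, grad, smul_sub, smul_comm (Complex.I * (η : ℂ))]
    have e : (Complex.I * (η : ℂ)) • Sect2.codiffCurlA ξ Z b.src b.dir = Sect2.codiffCurlA ξ (fun b => (Complex.I * (η : ℂ)) • Z b) b.src b.dir := by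
      simp only [Sect2.codiffCurlA, ec, Finset.smul_sum, smul_sub, smul_comm (Complex.I * (η : ℂ))]
    rw [e]; exact h.2.2 b hb

/-- `‖F(x+e_μ) − F(x)‖ = ξ·‖∇^ξ_μF(x)‖` for `ξ > 0`. [cite: Balaban1987RG1, (1.12) p.262 (bookkeeping)] -/
theorem norm_shift_sub_eq_mul_norm_grad {ξ : ℝ} (hξ : 0 < ξ) (μ : Fin P.d) (F : Site P 0 → MatA N) (x : Site P 0) :
    ‖F (x.shift μ) - F x‖ = ξ * ‖grad ξ μ F x‖ := by
  show ‖F (x.shift μ) - F x‖ = ξ * ‖(ξ : ℂ)⁻¹ • (F (x.shift μ) - F x)‖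
  rw [norm_smul, norm_inv, Complex.norm_real, Real.norm_eq_abs, abs_of_pos hξ, ← mul_assoc, mul_inv_cancel₀ hξ.ne', one_mul]

end Letters

/-! ## §3  The global weighted GRADIENT row of the truncation from (152)'s second member on the tower -/

section GradRows

variable {P : Params} {a : Pt P.d} {M ρ k : ℕ} {hk : k ≤ P.m + P.K} {N : ℕ}

/-- ★ **THE GRADIENT ROW, FOR AN ABSTRACT LEVEL FUNCTION** `lev` with `lev x ≤ k`, `x ∈ Ω_{lev x}` of the cube family, weights `w m b = (L^{lev b₋}·L^{−k})^m`: from (T2)'s level-0 member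
`‖A b‖ < κε·L^k` on `(regionOfSet (π″□₀)).bonds` and (T2b) `‖∇^η_νA_μ(x)‖ < κε·L^{2(k−j′)}` on the derivative stencils of `π″□_{j′}`, `j′ ≤ k` (`η = L^{−k}`), the truncation `Ã`
(`= A` on `(regionOfSet (π″□₀)).bonds`, `= 0` elsewhere) satisfies `w 2 b·L^k·‖Ã⟨b₋+e_ν, b_dir⟩ − Ã b‖ ≤ κε·L²` at every bond.
[cite: Balaban1985Variational, (152) p.301, p.286; Balaban1985RegularSpaces, p.98, (1.136) p.99] -/
theorem truncation_gradRows_of_T2b_aux (hρ : 2 ≤ ρ) (lev : Site P 0 → ℕ) (hlevk : ∀ x, lev x ≤ k)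
    (hlevin : ∀ x, (cubeDomains P a M ρ k hk).InOm (lev x) x) {w : ℕ → PBond P 0 → ℝ}
    (hw : ∀ m b, w m b = ((P.L : ℝ) ^ lev b.src * ((P.L : ℝ)⁻¹) ^ k) ^ m)
    {A At : PBond P 0 → MatA N} {κε : ℝ} (hκε : 0 ≤ κε)
    (hT20 : ∀ b ∈ (Sect2.regionOfSet P (cover P '' cube P.L a M ρ k 0)).bonds, ‖A b‖ < κε * (P.L : ℝ) ^ k)
    (hT2b : ∀ j', j' ≤ k → ∀ q ∈ (Sect2.regionOfSet P (cover P '' cube P.L a M ρ k j')).dpairs,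
      ‖grad (P.eta k) q.2.1 (fun y => A ⟨y, q.2.2⟩) q.1‖ < κε * (P.L : ℝ) ^ (2 * (k - j')))
    (hin : ∀ b ∈ (Sect2.regionOfSet P (cover P '' cube P.L a M ρ k 0)).bonds, At b = A b)
    (hout : ∀ b ∉ (Sect2.regionOfSet P (cover P '' cube P.L a M ρ k 0)).bonds, At b = 0) :
    ∀ (b : PBond P 0) (ν : Fin P.d), w 2 b * (P.L : ℝ) ^ k * ‖At ⟨b.src.shift ν, b.dir⟩ - At b‖ ≤ κε * (P.L : ℝ) ^ 2 := by
  classical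
  have hL1 : (1 : ℝ) ≤ P.L := by exact_mod_cast P.L_pos
  have hL0 : (0 : ℝ) < P.L := by positivity
  have hη0 : 0 < P.eta k := by unfold Params.eta; positivity
  -- weight identities: `(L^j·L^{−k})²·L^k·η·L^{2(k−j)+2} = L²` and `(L^0·L^{−k})²·L^k·L^k = 1`
  have hηk : P.eta k * (P.L : ℝ) ^ k = 1 := by
    unfold Params.eta; rw [inv_pow, inv_mul_cancel₀ (pow_ne_zero _ hL0.ne')]
  have hwk : ∀ {j : ℕ}, j ≤ k → ((P.L : ℝ) ^ j * ((P.L : ℝ)⁻¹) ^ k) ^ 2 * (P.L : ℝ) ^ k * (P.eta k * (P.L : ℝ) ^ (2 * (k - j + 1))) = (P.L : ℝ) ^ 2 := by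
    intro j hj
    have e1 : ((P.L : ℝ)⁻¹) ^ k = P.eta k := rfl
    have e2 : (P.L : ℝ) ^ (2 * (k - j + 1)) = ((P.L : ℝ) ^ (k - j)) ^ 2 * (P.L : ℝ) ^ 2 := by
      rw [← pow_mul, ← pow_add]; congr 1; omega
    have e3 : (P.L : ℝ) ^ j * (P.L : ℝ) ^ (k - j) = (P.L : ℝ) ^ k := by rw [← pow_add, Nat.add_sub_cancel' hj]
    rw [e1, e2]
    calc ((P.L : ℝ) ^ j * P.eta k) ^ 2 * (P.L : ℝ) ^ k * (P.eta k * (((P.L : ℝ) ^ (k - j)) ^ 2 * (P.L : ℝ) ^ 2))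
        = ((P.L : ℝ) ^ j * (P.L : ℝ) ^ (k - j)) ^ 2 * (P.eta k) ^ 2 * (P.eta k * (P.L : ℝ) ^ k) * (P.L : ℝ) ^ 2 := by ring
      _ = (P.L : ℝ) ^ 2 := by rw [e3, hηk, show ((P.L : ℝ) ^ k) ^ 2 * P.eta k ^ 2 = (P.eta k * (P.L : ℝ) ^ k) ^ 2 by ring, hηk]; ring
  have hw0k : ((P.L : ℝ) ^ 0 * ((P.L : ℝ)⁻¹) ^ k) ^ 2 * (P.L : ℝ) ^ k * (κε * (P.L : ℝ) ^ k) = κε * (P.eta k * (P.L : ℝ) ^ k) ^ 2 := by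
    have e1 : ((P.L : ℝ)⁻¹) ^ k = P.eta k := rfl
    rw [e1, pow_zero, one_mul]; ring
  intro b ν
  set x := b.src with hxdef
  have hw2 : 0 ≤ w 2 b := by rw [hw 2 b]; positivity
  have hR0 : ∀ b' : PBond P 0, b' ∈ (Sect2.regionOfSet P (cover P '' cube P.L a M ρ k 0)).bonds ↔
      b'.src ∈ cover P '' cube P.L a M ρ k 0 ∧ b'.tgt ∈ cover P '' cube P.L a M ρ k 0 := fun _ => Iff.rfl
  -- CASE SPLIT on the level of the source
  rcases Nat.eq_zero_or_pos (lev x) with h0 | hpos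
  · -- level `0`: both bonds in `R₀` (then the stencil `(x, ν, dir)` is a stencil of `π″□₀`), or one of them is cut
    by_cases hb : b ∈ (Sect2.regionOfSet P (cover P '' cube P.L a M ρ k 0)).bonds
    · by_cases hb' : (⟨x.shift ν, b.dir⟩ : PBond P 0) ∈ (Sect2.regionOfSet P (cover P '' cube P.L a M ρ k 0)).bonds
      · -- both in `R₀`: the derivative stencil of `π″□₀`
        rw [hin _ hb', hin _ hb]
        have hq : (x, ν, b.dir) ∈ (Sect2.regionOfSet P (cover P '' cube P.L a M ρ k 0)).dpairs :=
          ⟨((hR0 b).1 hb).1, ((hR0 _).1 hb').1, ((hR0 b).1 hb).2, ((hR0 _).1 hb').2⟩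
        have hg := hT2b 0 (Nat.zero_le k) _ hq
        have hn : ‖A ⟨x.shift ν, b.dir⟩ - A b‖ = P.eta k * ‖grad (P.eta k) ν (fun y => A ⟨y, b.dir⟩) x‖ := by
          rw [← norm_shift_sub_eq_mul_norm_grad hη0 ν (fun y => A ⟨y, b.dir⟩) x]
        rw [hn, Nat.sub_zero] at *
        calc w 2 b * (P.L : ℝ) ^ k * (P.eta k * ‖grad (P.eta k) ν (fun y => A ⟨y, b.dir⟩) x‖)
            ≤ w 2 b * (P.L : ℝ) ^ k * (P.eta k * (κε * (P.L : ℝ) ^ (2 * k))) := by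
              exact mul_le_mul_of_nonneg_left (mul_le_mul_of_nonneg_left hg.le hη0.le) (by positivity)
          _ = κε * (((P.L : ℝ) ^ 0 * ((P.L : ℝ)⁻¹) ^ k) ^ 2 * (P.L : ℝ) ^ k * (P.eta k * (P.L : ℝ) ^ (2 * (k - 0 + 1)))) * ((P.L : ℝ) ^ 2)⁻¹ := by
              rw [hw 2 b, ← hxdef, h0, show 2 * (k - 0 + 1) = 2 * k + 2 by omega, pow_add]
              field_simp
          _ = κε * (P.L : ℝ) ^ 2 * ((P.L : ℝ) ^ 2)⁻¹ := by rw [hwk (Nat.zero_le k)]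
          _ = κε := by rw [mul_assoc, mul_inv_cancel₀ (pow_ne_zero _ hL0.ne'), mul_one]
          _ ≤ κε * (P.L : ℝ) ^ 2 := le_mul_of_one_le_right hκε (one_le_pow₀ hL1)
      · -- `b ∈ R₀`, the translate cut: `‖0 − A b‖ < κε L^k`
        rw [hout _ hb', hin _ hb, zero_sub, norm_neg]
        calc w 2 b * (P.L : ℝ) ^ k * ‖A b‖ ≤ w 2 b * (P.L : ℝ) ^ k * (κε * (P.L : ℝ) ^ k) :=
              mul_le_mul_of_nonneg_left (hT20 b hb).le (by positivity)
          _ = κε * (P.eta k * (P.L : ℝ) ^ k) ^ 2 := by rw [hw 2 b, ← hxdef, h0, hw0k]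
          _ = κε := by rw [hηk, one_pow, mul_one]
          _ ≤ κε * (P.L : ℝ) ^ 2 := le_mul_of_one_le_right hκε (one_le_pow₀ hL1)
    · by_cases hb' : (⟨x.shift ν, b.dir⟩ : PBond P 0) ∈ (Sect2.regionOfSet P (cover P '' cube P.L a M ρ k 0)).bonds
      · rw [hin _ hb', hout _ hb, sub_zero]
        calc w 2 b * (P.L : ℝ) ^ k * ‖A ⟨x.shift ν, b.dir⟩‖ ≤ w 2 b * (P.L : ℝ) ^ k * (κε * (P.L : ℝ) ^ k) :=
              mul_le_mul_of_nonneg_left (hT20 _ hb').le (by positivity)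
          _ = κε * (P.eta k * (P.L : ℝ) ^ k) ^ 2 := by rw [hw 2 b, ← hxdef, h0, hw0k]
          _ = κε := by rw [hηk, one_pow, mul_one]
          _ ≤ κε * (P.L : ℝ) ^ 2 := le_mul_of_one_le_right hκε (one_le_pow₀ hL1)
      · rw [hout _ hb', hout _ hb, sub_zero, norm_zero, mul_zero]
        positivity
  · -- level `j ≥ 1`: the stencil `(x, ν, dir)` is a derivative stencil of `π″□_{j−1}`, and both bonds lie in `R₀`
    obtain ⟨h1, h2⟩ := mem_bonds_pred_of_inOm (hk := hk) hpos (hlevk x) hρ (hlevin x) b.dir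
    have hk' : lev x - 1 ≤ k := by have := hlevk x; omega
    have hsub : (Sect2.regionOfSet P (cover P '' cube P.L a M ρ k (lev x - 1))).bonds ⊆ (Sect2.regionOfSet P (cover P '' cube P.L a M ρ k 0)).bonds := by
      intro b' hb'
      exact ⟨Set.image_mono (cube_anti (Nat.zero_le _) hk') hb'.1, Set.image_mono (cube_anti (Nat.zero_le _) hk') hb'.2⟩
    have hbx : b = ⟨x, b.dir⟩ := by cases b; rfl
    have hbR : b ∈ (Sect2.regionOfSet P (cover P '' cube P.L a M ρ k 0)).bonds := by rw [hbx]; exact hsub h1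
    have hb'R : (⟨x.shift ν, b.dir⟩ : PBond P 0) ∈ (Sect2.regionOfSet P (cover P '' cube P.L a M ρ k 0)).bonds := hsub (h2 ν)
    rw [hin _ hb'R, hin _ hbR]
    have hq : (x, ν, b.dir) ∈ (Sect2.regionOfSet P (cover P '' cube P.L a M ρ k (lev x - 1))).dpairs :=
      ⟨h1.1, (h2 ν).1, h1.2, (h2 ν).2⟩
    have hg := hT2b (lev x - 1) hk' _ hq
    have hexp : k - (lev x - 1) = k - lev x + 1 := by have := hlevk x; omega
    rw [hexp] at hg
    have hn : ‖A ⟨x.shift ν, b.dir⟩ - A b‖ = P.eta k * ‖grad (P.eta k) ν (fun y => A ⟨y, b.dir⟩) x‖ := by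
      rw [hbx, ← norm_shift_sub_eq_mul_norm_grad hη0 ν (fun y => A ⟨y, b.dir⟩) x]
    rw [hn]
    calc w 2 b * (P.L : ℝ) ^ k * (P.eta k * ‖grad (P.eta k) ν (fun y => A ⟨y, b.dir⟩) x‖)
        ≤ w 2 b * (P.L : ℝ) ^ k * (P.eta k * (κε * (P.L : ℝ) ^ (2 * (k - lev x + 1)))) := by
          exact mul_le_mul_of_nonneg_left (mul_le_mul_of_nonneg_left hg.le hη0.le) (by positivity)
      _ = κε * (((P.L : ℝ) ^ lev x * ((P.L : ℝ)⁻¹) ^ k) ^ 2 * (P.L : ℝ) ^ k * (P.eta k * (P.L : ℝ) ^ (2 * (k - lev x + 1)))) := by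
          rw [hw 2 b, ← hxdef]; ring
      _ = κε * (P.L : ℝ) ^ 2 := by rw [hwk (hlevk x)]

/-- ★★★ **THE TRUNCATION `Ã = 𝟙_{π″□₀}·A` HAS THE SUPPLIER's GLOBAL WEIGHTED GRADIENT ROW** (tower `k ≤ m + K`, collar `ρ ≥ 2`; `w` the (152) level weights of the meet `cubeDomains ⊓ D₂`,
k0-s1's `IsLevWeight`): from the head token's (T2) level-0 member and print's (152) SECOND member (T2b) on the tower, `w 2 b·L^k·‖Ã(b + e_ν) − Ã b‖ ≤ κε·L²` at every bond of the torus.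
[cite: Balaban1985Variational, (152) p.301, p.286; Balaban1985RegularSpaces, p.98, (1.136) p.99] -/
theorem truncation_gradRows_of_T2b (D₂ : Domains P) (hρ : 2 ≤ ρ) {w : ℕ → PBond P 0 → ℝ}
    (hw : IsLevWeight P k (domainsMeet (cubeDomains P a M ρ k hk) D₂) w)
    {A At : PBond P 0 → MatA N} {κε : ℝ} (hκε : 0 ≤ κε)
    (hT20 : ∀ b ∈ (Sect2.regionOfSet P (cover P '' cube P.L a M ρ k 0)).bonds, ‖A b‖ < κε * (P.L : ℝ) ^ k)
    (hT2b : ∀ j', j' ≤ k → ∀ q ∈ (Sect2.regionOfSet P (cover P '' cube P.L a M ρ k j')).dpairs,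
      ‖grad (P.eta k) q.2.1 (fun y => A ⟨y, q.2.2⟩) q.1‖ < κε * (P.L : ℝ) ^ (2 * (k - j')))
    (hin : ∀ b ∈ (Sect2.regionOfSet P (cover P '' cube P.L a M ρ k 0)).bonds, At b = A b)
    (hout : ∀ b ∉ (Sect2.regionOfSet P (cover P '' cube P.L a M ρ k 0)).bonds, At b = 0) :
    ∀ (b : PBond P 0) (ν : Fin P.d), w 2 b * (P.L : ℝ) ^ k * ‖At ⟨b.src.shift ν, b.dir⟩ - At b‖ ≤ κε * (P.L : ℝ) ^ 2 :=
  truncation_gradRows_of_T2b_aux hρ _ (fun x => (inOm_cube_levOf (a := a) (M := M) (ρ := ρ) (hk := hk) D₂ x).1)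
    (fun x => (inOm_cube_levOf (a := a) (M := M) (ρ := ρ) (hk := hk) D₂ x).2) hw hκε hT20 hT2b hin hout

end GradRows

/-! ## §4  The chart parameter's slice row and the transfer of the conclusion to the head token's currency -/

section Transfer

variable {P : Params} {a : Pt P.d} {M ρ k : ℕ} {hk : k ≤ P.m + P.K} {N : ℕ}

/-- `Re((iη)·z) = −η·Im z`. [folklore] -/
theorem re_I_eta_mul (η : ℝ) (z : ℂ) : ((Complex.I * (η : ℂ)) * z).re = -η * z.im := by
  simp [Complex.mul_re, Complex.mul_im]

/-- `Im z = Re((−i)·z)`. [folklore] -/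
theorem im_eq_re_neg_I_mul (z : ℂ) : z.im = ((-Complex.I) * z).re := by
  simp [Complex.mul_re]

/-- ★★ **THE (153) SLICE ROW OF THE CHART PARAMETER** `X = iη·(Ã + H Z)` on `D′ =` the meet `cubeDomains ⊓ D₂` (`1 ≤ k`, `ρ ≥ 2`; `H` any matrix kernel
`H X b = Σ_t κ_t·flatH(𝟙_t)(b)•X t`): from the head token's slice rows `R∂*(Re φ A) = R∂*(Im φ A) = 0` at `D′` for every ℂ-linear `φ`, and `Ã = A` on `(regionOfSet (π″□₀)).bonds`:
`R∂*(Re φ X) = 0` — `Re φ(iη v) = −η·Im φ(v) = −η·Re((−i•φ)(v))`, the rows pass `A → Ã` (MODULE 107 §3) and `Ã → Ã + H Z` (MODULE 105 §3).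
[cite: Balaban1985Variational, (45) p.285, (153) p.301, (159) p.303; Balaban1984PropagatorsII, (2.9)–(2.12) pp.224–225, (2.34)–(2.35) p.228] -/
theorem slice_row_chart_of_eq (D₂ : Domains P) {D' : Domains P} (hD' : D' = domainsMeet (cubeDomains P a M ρ k hk) D₂) (hk1 : 1 ≤ k) (hρ : 2 ≤ ρ)
    (κv : BondIdx D' → ℝ) (H : (BondIdx D' → Matrix (Fin N) (Fin N) ℂ) →ₗ[ℂ] (PBond P 0 → Matrix (Fin N) (Fin N) ℂ))
    (hH : ∀ (X : BondIdx D' → Matrix (Fin N) (Fin N) ℂ) (b : PBond P 0), H X b = ∑ t, (((κv t * flatH P k D' (Pi.single t 1) b : ℝ) : ℂ)) • X t)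
    (A At : PBond P 0 → Matrix (Fin N) (Fin N) ℂ) (hin : ∀ b ∈ (Sect2.regionOfSet P (cover P '' cube P.L a M ρ k 0)).bonds, At b = A b)
    (Z : BondIdx D' → Matrix (Fin N) (Fin N) ℂ) (η : ℝ)
    (h153 : ∀ φ : Matrix (Fin N) (Fin N) ℂ →L[ℂ] ℂ,
      RE D' ((P.L : ℝ) ^ k) (dsE ((P.L : ℝ) ^ k) (WithLp.toLp 2 fun b => (φ (A b)).re : BondSpace P)) = 0 ∧
      RE D' ((P.L : ℝ) ^ k) (dsE ((P.L : ℝ) ^ k) (WithLp.toLp 2 fun b => (φ (A b)).im : BondSpace P)) = 0)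
    (φ : Matrix (Fin N) (Fin N) ℂ →L[ℂ] ℂ) :
    RE D' ((P.L : ℝ) ^ k) (dsE ((P.L : ℝ) ^ k) (WithLp.toLp 2 fun b => (φ ((Complex.I * (η : ℂ)) • (At + H Z) b)).re : BondSpace P)) = 0 := by
  subst hD'
  set ψ : Matrix (Fin N) (Fin N) ℂ →L[ℂ] ℂ := (-Complex.I) • φ with hψ
  -- `Re φ(iη v) = −η · Re ψ(v)`
  have hre : (fun b => (φ ((Complex.I * (η : ℂ)) • (At + H Z) b)).re) = (-η) • (fun b => (ψ ((At + H Z) b)).re) := by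
    funext b
    rw [Pi.smul_apply, smul_eq_mul, map_smul, smul_eq_mul, re_I_eta_mul, hψ, smul_apply, smul_eq_mul, ← im_eq_re_neg_I_mul]
  have hsm : (WithLp.toLp 2 fun b => (φ ((Complex.I * (η : ℂ)) • (At + H Z) b)).re : BondSpace P) =
      (-η) • (WithLp.toLp 2 fun b => (ψ ((At + H Z) b)).re : BondSpace P) := by
    rw [hre, WithLp.toLp_smul]
  -- the rows of `ψ`: `Ã + H Z → Ã → A`, and `Re ψ(A b) = Im φ(A b)`
  have h1 := RE_dsE_re_add_kernelH k (domainsMeet (cubeDomains P a M ρ k hk) D₂) κv H hH ψ At Z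
  have h2 := RE_dsE_truncation_eq (a := a) (M := M) (ρ := ρ) (hk := hk) D₂ hk1 hρ ((P.L : ℝ) ^ k) (fun b => (ψ (A b)).re) (fun b => (ψ (At b)).re)
    (fun b hb => by simp only [hin b hb])
  have h3 : (fun b => (ψ (A b)).re) = fun b => (φ (A b)).im := by
    funext b; rw [hψ, smul_apply, smul_eq_mul, ← im_eq_re_neg_I_mul]
  rw [hsm, map_smul, map_smul, h1, h2, h3, (h153 φ).2, smul_zero]

open scoped Classical in
/-- ★★ **THE SUPPLIER's CONCLUSION IN THE HEAD TOKEN's CURRENCY**: on a window `Y ⊆ π″□₀` of the tower (`1 ≤ k`, `ρ ≥ 3L`), for the plain kernels `Q_V`, `H_V` of `D′ =` the meet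
and `Ã = A` on `(regionOfSet (π″□₀)).bonds`: `Letters10On Y ξ t (Ã − H_V(Q_V Ã))` implies `Letters10On Y ξ t (A − H_V(𝟙_reach·QA))` — the three letters read only bonds of `Y` (§2), where
`Ã = A`, the reach cut-off is invisible (MODULE 106), and on reaching cells the straight averages of `Ã` and `A` agree (they read only bonds of `π″□₀`).
[cite: Balaban1985Variational, (157)–(159) pp.302–303, (162) p.303; Balaban1984PropagatorsII, (2.20) p.226, (2.35) p.228; Balaban1984PropagatorsI, (1.18) p.20] -/
theorem letters_transfer_of_eq (D₂ : Domains P) {D' : Domains P} (hD' : D' = domainsMeet (cubeDomains P a M ρ k hk) D₂) (hk1 : 1 ≤ k) (hρ : 3 * P.L ≤ ρ)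
    {instDE : DecidableEq (PBond P 0)}
    (QV : (PBond P 0 → Matrix (Fin N) (Fin N) ℂ) →ₗ[ℂ] (BondIdx D' → Matrix (Fin N) (Fin N) ℂ))
    (hQV : ∀ (A : PBond P 0 → Matrix (Fin N) (Fin N) ℂ) (t : BondIdx D'), QV A t = ∑ j, ((WithLp.ofLp (QE D' (WithLp.toLp 2 (Pi.single j 1))) t : ℝ) : ℂ) • A j)
    (HV : (BondIdx D' → Matrix (Fin N) (Fin N) ℂ) →ₗ[ℂ] (PBond P 0 → Matrix (Fin N) (Fin N) ℂ))
    (hHV : ∀ (Bf : BondIdx D' → Matrix (Fin N) (Fin N) ℂ) (b : PBond P 0), HV Bf b = ∑ c, ((flatH P k D' (Pi.single c 1) b : ℝ) : ℂ) • Bf c)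
    (A At : PBond P 0 → Matrix (Fin N) (Fin N) ℂ) (hin : ∀ b ∈ (Sect2.regionOfSet P (cover P '' cube P.L a M ρ k 0)).bonds, At b = A b)
    {Y : Set (Site P 0)} (hY : Y ⊆ cover P '' cube P.L a M ρ k 0) {ξ t : ℝ}
    (h : Letters10On Y ξ t (At - HV (QV At))) :
    Letters10On Y ξ t (fun b => A b - HV (fun c : BondIdx D' =>
      if (∀ x : Site P 0, (iterBlockOf (c.1.1 : ℕ) x = c.1.2.src ∨ iterBlockOf (c.1.1 : ℕ) x = c.1.2.tgt) → x ∈ cover P '' cube P.L a M ρ k 0)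
      then bondAvgIter (c.1.1 : ℕ) A c.1.2 else 0) b) := by
  subst hD'
  refine Letters10On.congr_bonds ?_ h
  intro b hb
  have hbR : b.src ∈ cover P '' cube P.L a M ρ k 0 ∧ b.tgt ∈ cover P '' cube P.L a M ρ k 0 := ⟨hY hb.1, hY hb.2⟩
  rw [Pi.sub_apply, hin b hbR, hHV, hHV]
  congr 1
  -- on reaching cells `Q(Ã) = Q(A)`: they read only bonds with both ends in `π″□₀`
  have hreach : ∀ c : BondIdx (domainsMeet (cubeDomains P a M ρ k hk) D₂),
      (if (∀ x : Site P 0, (iterBlockOf (c.1.1 : ℕ) x = c.1.2.src ∨ iterBlockOf (c.1.1 : ℕ) x = c.1.2.tgt) → x ∈ cover P '' cube P.L a M ρ k 0)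
        then bondAvgIter (c.1.1 : ℕ) A c.1.2 else 0) =
      (if (∀ x : Site P 0, (iterBlockOf (c.1.1 : ℕ) x = c.1.2.src ∨ iterBlockOf (c.1.1 : ℕ) x = c.1.2.tgt) → x ∈ cover P '' cube P.L a M ρ k 0)
        then QV At c else 0) := by
    intro c
    by_cases hc : ∀ x : Site P 0, (iterBlockOf (c.1.1 : ℕ) x = c.1.2.src ∨ iterBlockOf (c.1.1 : ℕ) x = c.1.2.tgt) → x ∈ cover P '' cube P.L a M ρ k 0
    · rw [if_pos hc, if_pos hc, K0Stub1FlatAveragingDictionary.QV_apply_eq_bondAvgIter _ hQV]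
      have hcm : (c.1.1 : ℕ) ≤ P.m + P.K := (Nat.lt_succ_iff.mp c.1.1.2).trans (domainsMeet (cubeDomains P a M ρ k hk) D₂).hk
      exact bondAvgIter_congr_of_reads hcm c.1.2 fun b' h1 h2 => (hin b' ⟨hc _ h1, hc _ h2⟩).symm
    · rw [if_neg hc, if_neg hc]
  simp_rw [hreach, Complex.coe_smul]
  exact (kernelH_indicator_reach_eq D₂ k hk1 hρ (QV At) hbR).symm

end Transfer

end Summit.QuantumFields.YangMills.BalabanUVNodes.N07DPrimeAssemblyKit

end
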